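import Mathlib.Analysis.InnerProductSpace.PiL2
import Mathlib.LinearAlgebra.Matrix.NonsingularInverse
import Mathlib.Data.Matrix.Block
import HarnessLib

/-!
# Route `CylinderEntropy`, item `ImmortalAreaToFloor` (stmt-SmoothPoincare4-17197):
# Gram determinants after deleting TWO orthonormal coordinates (Jacobi's complementary minor)

Brick (CO', linear algebra) of the Allard-free blueprint for the residual `ThinSeq` of the item (evidence
`ANALYSIS-prover-17197-c1.md`, §8).  The coarea step bounds the `4`-volume of the image of a piece of the
cross-section `Σ⁴ ⊂ S⁴ × ℝ ⊂ ℝ⁶` under "height and three of the four chart coordinates", i.e. under the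
coordinates with respect to FOUR vectors of an orthonormal basis `B` of `ℝ⁶`; its Jacobian in a chart of `Σ`
is the determinant computed here:

* **`det_gram_coords_inl`** — for `w₀, …, w₃` with non-zero Gram determinant and an orthonormal pair `n, ν`
  orthogonal to all `wᵢ` (so that `(w; n, ν)` is a basis of the `6`-space spanned), and an orthonormal basis
  `B` indexed by `Fin 4 ⊕ Fin 2`:
  `det (∑ₖ ⟪B (inl k), wᵢ⟫ ⟪B (inl k), wⱼ⟫)ᵢⱼ = (⟪B₄, n⟫⟪B₅, ν⟫ - ⟪B₅, n⟫⟪B₄, ν⟫)² · det (⟪wᵢ, wⱼ⟫)ᵢⱼ`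
  (`B₄ = B (inr 0)`, `B₅ = B (inr 1)`): the squared volume of the projection of the parallelepiped of `w` onto
  `span {B (inl k)}` is its squared volume times the squared `2 × 2` determinant pairing the deleted directions
  with the normal plane.  Proof: for the coordinate matrix `M = (⟪B k, c l⟫)` of `c = (w; n, ν)`, `Mᵀ M = Gram c =
  Gram w ⊕ 1`, the `(n, ν)`-rows of `M⁻¹` are the coordinates of `n, ν`, and the block identity
  `M · [[1, F], [0, H]] = [[A, 0], [C, 1]]` (`M⁻¹ = [[E, F], [G, H]]`) gives `det A = det M · det H`.

Everything is proved; no definition, no named fact.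
-/

noncomputable section

-- the prescribed namespace `Summit.SmoothPoincare4.SmoothPoincare4.…` repeats `SmoothPoincare4`
set_option linter.dupNamespace false

open scoped RealInnerProductSpace BigOperators

namespace Summit.SmoothPoincare4.SmoothPoincare4.Theorems.CoareaShadow

variable {V : Type*} [NormedAddCommGroup V] [InnerProductSpace ℝ V]

/-- **Gram determinant of the coordinates with respect to four of six orthonormal vectors** (Jacobi's
complementary-minor identity for Gram matrices). See the module docstring. [folklore] -/
theorem det_gram_coords_inl (B : OrthonormalBasis (Fin 4 ⊕ Fin 2) ℝ V) (w : Fin 4 → V) (n ν : V)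
    (hn : ∀ i, ⟪n, w i⟫ = 0) (hν : ∀ i, ⟪ν, w i⟫ = 0) (hnν : ⟪ν, n⟫ = 0) (hn1 : ‖n‖ = 1) (hν1 : ‖ν‖ = 1)
    (hdet : (Matrix.of fun i j => ⟪w i, w j⟫).det ≠ 0) :
    (Matrix.of fun i j => ∑ k : Fin 4, ⟪B (Sum.inl k), w i⟫ * ⟪B (Sum.inl k), w j⟫).det =
      (⟪B (Sum.inr 0), n⟫ * ⟪B (Sum.inr 1), ν⟫ - ⟪B (Sum.inr 1), n⟫ * ⟪B (Sum.inr 0), ν⟫) ^ 2 *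
        (Matrix.of fun i j => ⟪w i, w j⟫).det := by
  classical
  -- the family `c = (w; n, ν)` and its coordinate matrix `M`
  set c : Fin 4 ⊕ Fin 2 → V := Sum.elim w ![n, ν] with hc
  set M : Matrix (Fin 4 ⊕ Fin 2) (Fin 4 ⊕ Fin 2) ℝ := Matrix.of fun k l => ⟪B k, c l⟫ with hM
  set Gw : Matrix (Fin 4) (Fin 4) ℝ := Matrix.of fun i j => ⟪w i, w j⟫ with hGw
  have hc0 : c (Sum.inr 0) = n := by simp [hc]
  have hc1 : c (Sum.inr 1) = ν := by simp [hc]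
  have hcl : ∀ i, c (Sum.inl i) = w i := fun i => by simp [hc]
  -- `Gram(c) = Gw ⊕ 1`
  have hcc : ∀ k l, ⟪c k, c l⟫ = (Matrix.fromBlocks Gw 0 0 (1 : Matrix (Fin 2) (Fin 2) ℝ)) k l := by
    intro k l
    rcases k with i | a <;> rcases l with j | b
    · rw [Matrix.fromBlocks_apply₁₁, hcl, hcl, hGw, Matrix.of_apply]
    · rw [Matrix.fromBlocks_apply₁₂, hcl, Matrix.zero_apply]
      fin_cases b
      · simpa [hc, real_inner_comm] using hn i
      · simpa [hc, real_inner_comm] using hν i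
    · rw [Matrix.fromBlocks_apply₂₁, hcl, Matrix.zero_apply]
      fin_cases a
      · simpa [hc] using hn j
      · simpa [hc] using hν j
    · rw [Matrix.fromBlocks_apply₂₂, Matrix.one_apply]
      fin_cases a <;> fin_cases b
      · simp [hc, hn1]
      · simpa [hc, real_inner_comm] using hnν
      · simpa [hc] using hnν
      · simp [hc, hν1]
  -- Parseval: `∑ₘ ⟪B m, x⟫ ⟪B m, y⟫ = ⟪x, y⟫`
  have hpars : ∀ x y : V, ∑ m, ⟪B m, x⟫ * ⟪B m, y⟫ = ⟪x, y⟫ := by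
    intro x y
    rw [← B.sum_inner_mul_inner x y]
    exact Finset.sum_congr rfl fun m _ => by rw [real_inner_comm (B m) x]
  -- (1) `Mᵀ M = Gw ⊕ 1`, so `det M ^ 2 = det Gw ≠ 0`
  have hGc : M.transpose * M = Matrix.fromBlocks Gw 0 0 (1 : Matrix (Fin 2) (Fin 2) ℝ) := by
    ext k l
    rw [← hcc k l]
    simp only [Matrix.mul_apply, Matrix.transpose_apply, hM, Matrix.of_apply]
    exact hpars (c k) (c l)
  have hdetM : M.det ^ 2 = Gw.det := by
    have h := Matrix.det_mul M.transpose M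
    rw [Matrix.det_transpose, hGc, Matrix.det_fromBlocks_zero₂₁, Matrix.det_one, mul_one] at h
    rw [sq, ← h]
  have hMdet : M.det ≠ 0 := by
    intro h0
    apply hdet
    rw [← hdetM, h0]
    ring
  have hMu : IsUnit M.det := isUnit_iff_ne_zero.2 hMdet
  set N : Matrix (Fin 4 ⊕ Fin 2) (Fin 4 ⊕ Fin 2) ℝ := M⁻¹ with hN
  have hMN : M * N = 1 := Matrix.mul_nonsing_inv M hMu
  have hNM : N * M = 1 := Matrix.nonsing_inv_mul M hMu
  -- (2) the `inr`-rows of `N` are the coordinates of `n, ν`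
  have hrow : ∀ (a : Fin 2) (l : Fin 4 ⊕ Fin 2), N (Sum.inr a) l = ⟪B l, c (Sum.inr a)⟫ := by
    set R : Matrix (Fin 2) (Fin 4 ⊕ Fin 2) ℝ := Matrix.of fun a l => ⟪B l, c (Sum.inr a)⟫ with hR
    set Nr : Matrix (Fin 2) (Fin 4 ⊕ Fin 2) ℝ := Matrix.of fun a l => N (Sum.inr a) l with hNr
    have hRM : R * M = Nr * M := by
      ext a l
      have h1 : (R * M) a l = ⟪c (Sum.inr a), c l⟫ := by
        simp only [Matrix.mul_apply, hR, hM, Matrix.of_apply]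
        exact hpars _ _
      have h2 : (Nr * M) a l = (N * M) (Sum.inr a) l := by
        simp only [Matrix.mul_apply, hNr, Matrix.of_apply]
      rw [h1, h2, hNM, hcc, ← Matrix.fromBlocks_one]
      rcases l with j | b
      · rw [Matrix.fromBlocks_apply₂₁, Matrix.fromBlocks_apply₂₁]
      · rw [Matrix.fromBlocks_apply₂₂, Matrix.fromBlocks_apply₂₂]
    have hReq : R = Nr := by
      calc R = R * (M * N) := by rw [hMN, Matrix.mul_one]
        _ = Nr * (M * N) := by rw [← Matrix.mul_assoc, hRM, Matrix.mul_assoc]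
        _ = Nr := by rw [hMN, Matrix.mul_one]
    intro a l
    have := congrFun (congrFun hReq a) l
    simp only [hR, hNr, Matrix.of_apply] at this
    exact this.symm
  -- (3) the block identity `det A = det M · det H`
  have hblocks : M.toBlocks₁₁.det = M.det * N.toBlocks₂₂.det := by
    have hM' := Matrix.fromBlocks_toBlocks M
    have hN' := Matrix.fromBlocks_toBlocks N
    have hprod := hMN
    rw [← hM', ← hN', Matrix.fromBlocks_multiply, ← Matrix.fromBlocks_one, Matrix.fromBlocks_inj] at hprod
    obtain ⟨-, h12, -, h22⟩ := hprod
    have hkey : Matrix.fromBlocks M.toBlocks₁₁ M.toBlocks₁₂ M.toBlocks₂₁ M.toBlocks₂₂ *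
        Matrix.fromBlocks (1 : Matrix (Fin 4) (Fin 4) ℝ) N.toBlocks₁₂ 0 N.toBlocks₂₂ =
        Matrix.fromBlocks M.toBlocks₁₁ 0 M.toBlocks₂₁ (1 : Matrix (Fin 2) (Fin 2) ℝ) := by
      rw [Matrix.fromBlocks_multiply, h12, h22]
      simp only [Matrix.mul_one, Matrix.mul_zero, add_zero]
    have hd := congrArg Matrix.det hkey
    rw [Matrix.det_mul, hM', Matrix.det_fromBlocks_zero₂₁, Matrix.det_one, one_mul,
      Matrix.det_fromBlocks_zero₁₂, Matrix.det_one, mul_one] at hd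
    exact hd.symm
  -- (4) the target Gram matrix is `Aᵀ A`, and `det H` is the `2 × 2` determinant
  have hA : (Matrix.of fun i j => ∑ k : Fin 4, ⟪B (Sum.inl k), w i⟫ * ⟪B (Sum.inl k), w j⟫) =
      M.toBlocks₁₁.transpose * M.toBlocks₁₁ := by
    ext i j
    simp only [Matrix.mul_apply, Matrix.transpose_apply, Matrix.toBlocks₁₁, hM, Matrix.of_apply, hcl]
  have hH : N.toBlocks₂₂.det =
      ⟪B (Sum.inr 0), n⟫ * ⟪B (Sum.inr 1), ν⟫ - ⟪B (Sum.inr 1), n⟫ * ⟪B (Sum.inr 0), ν⟫ := by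
    rw [Matrix.det_fin_two]
    simp only [Matrix.toBlocks₂₂, Matrix.of_apply, hrow, hc0, hc1]
  rw [hA, Matrix.det_mul, Matrix.det_transpose, hblocks, hH, ← hdetM]
  ring

end Summit.SmoothPoincare4.SmoothPoincare4.Theorems.CoareaShadow

end
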